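import Summits.HubbardSuperconductivity.HubbardSuperconductivity.Theorems.AnisotropyChordTransferFibre3FamilyALemmas
import Literature.Analysis.Fourier.SquareWaveSineSeries

/-!
# Route `AnisotropyChord` / H0 rotor rung: PartN38 — the odd-sine identity `OddSineSum` PROVED

Typed target `OddSineSum` of `…Fibre3FamilyALemmas` (PORT PartN38, theory seat `hubbard-h0-rotor-theory-1` g21, memo 21 §316;
used for the diagonal kernel values `a_∞(n,n) = (1/π)Σ_{j≤n} 1/(2j−1)`):
`sin u · Σ_{j=1}^{n} sin((2j−1)u) = sin²(nu)` for every `n` and every real `u`.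
Proof: induction on `n` with `sin²((n+1)u) − sin²(nu) = sin((2n+1)u)·sin u` (`Literature.Analysis.Fourier.sin_add_mul_sin_sub`;
cf. `sin_mul_sum_sin_odd` there, the same identity indexed from `0`).
Prover seat `hubbard-h0-rotor-p1` g23; helper for stmt-HubbardSuperconductivity-19089 (`--supports`).
-/

set_option linter.dupNamespace false
set_option autoImplicit false

noncomputable section

open scoped BigOperators

namespace Summit.HubbardSuperconductivity.HubbardSuperconductivity.Theorems.AnisotropyChord.Transfer.Fibre3

/-- ★ **`OddSineSum` holds:** `sin u · Σ_{j=1}^{n} sin((2j−1)u) = sin²(nu)`. [folklore] -/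
theorem oddSineSum_holds : OddSineSum := by
  intro n u
  induction n with
  | zero => simp
  | succ n ih =>
    rw [Finset.sum_Icc_succ_top (by omega : 1 ≤ n + 1), mul_add, ih]
    push_cast
    have e : (2 * ((n : ℝ) + 1) - 1) * u = ((n : ℝ) + 1) * u + (n : ℝ) * u := by ring
    have hu : Real.sin u = Real.sin (((n : ℝ) + 1) * u - (n : ℝ) * u) := by congr 1; ring
    rw [e, hu, mul_comm (Real.sin _) (Real.sin _), Literature.Analysis.Fourier.sin_add_mul_sin_sub]
    ring

end Summit.HubbardSuperconductivity.HubbardSuperconductivity.Theorems.AnisotropyChord.Transfer.Fibre3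

end
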